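import Mathlib
import Summits.Ventures.HodgeRepro2.T6N5LocalSignModel
import Summits.Ventures.HodgeRepro2.T6N5LocalRamWitness
import Summits.Ventures.HodgeRepro2.T6N5LocalGaussianWitness
import Summits.Ventures.HodgeRepro2.T6N5LocalInertWitness

/-!
# T6N5LocalSignModelWitness — Tier 6, M2 sub-step N5 (t6-p8's half): THE §10.5(ii)(c),(d) WITNESS of
`T6N5LocalSignModel` — a place family on a concrete pair of number fields inside Mathlib, its local input with
every per-place hypothesis discharged, a real place with t6-p7's toy real data, and the resulting sign model
with `hsol` and `hre` both theorems; the same for a rich N5 datum carrying that sign model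

* `gaussianInput w ψδ hK : LocalInput v₂ w` — the local input at `ℚ₂ ⊆ ℚ₂(i)` (p4's `T5GaussianPlace`, wildly
  ramified) from the toy ε-factor parameter and the toy Weil representation of `T6N5LocalRamWitness`;
  `gaussianInput_hyps` — its `Hyps` hold (the ramified displays `hT6_toy` / `hG_toy` / `h35_toy`, both smoothness
  properties, `ϵ_δ(W) = 1`, `χ_W` conjugate-symplectic);
* `eisensteinInput w : LocalInput v₂ w` — the same at the inert place `ℚ₂ ⊆ ℚ₂(ω)` (p4's `T5EisensteinInertPlace`)
  from `T6N5LocalInertWitness`; `eisensteinInput_hyps`;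
* `gaussianFamily w ψδ hK : PlaceFamily ℚ L Bool` — two places: `true` the finite non-split place above `2`,
  `false` a real place; `gaussianFamily_hyps`; with t6-p7's toy real data on both sides,
  `gaussianFamily_solves_realCondB` — `hsol ∧ hre` of its sign model, every hypothesis discharged;
* `exists_signModel_solves_realCondB` — the closed form: there is a place family on `ℚ ⊆ ℚ(ζ₄)` whose sign model
  satisfies `Solves ∧ RealCondB`; `eisensteinFamily_solves` the inert analogue over `Unit`;
* `witnessRich` — a rich N5 datum (t6-p7's toy carriers, trivial restrictions) whose sign model is the Gaussian
  family's, with `witnessRich_solves_realCondB : witnessRich.S.Solves ∧ witnessRich.S.RealCondB` through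
  `PlaceFamily.solves_realCondB_of_eq` — the shape of ledger rows 183–184 instantiated.
README §8(d): uses an L-value-free non-vanishing device: NO.
-/

namespace Summit.Ventures.HodgeRepro2.T6.N5LocalSignModelWitness

open Summit.Ventures.HodgeRepro2 IsDedekindDomain HeightOneSpectrum
  Summit.Ventures.HodgeRepro2.T6.N5LocalDatum Summit.Ventures.HodgeRepro2.T6.N5Local
  Summit.Ventures.HodgeRepro2.T6.Hyp Summit.Ventures.HodgeRepro2.T6.N5LocalTateChars
  Summit.Ventures.HodgeRepro2.T6.N5LocalWeilQuotient Summit.Ventures.HodgeRepro2.T6.N5LocalWeilQuotientSmooth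
  Summit.Ventures.HodgeRepro2.T6.N5LocalQuotientToy Summit.Ventures.HodgeRepro2.T6.N5LocalRamToyEps
  Summit.Ventures.HodgeRepro2.T6.N5LocalInertToyEps Summit.Ventures.HodgeRepro2.T6.N5LocalRamCompletion
  Summit.Ventures.HodgeRepro2.T6.N5LocalInertCompletion
  Summit.Ventures.HodgeRepro2.T6.N5LocalSignModel Summit.Ventures.HodgeRepro2.T6.N5Rich
  Summit.Ventures.HodgeRepro2.T6.N5RealPlace Summit.Ventures.HodgeRepro2.T6.N5LocalGaussianWitness

noncomputable section

/-! ### The local input at the wildly ramified place `ℚ₂ ⊆ ℚ₂(i)` -/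

section Gaussian

open T5GaussianField N5LocalRamWitness

variable (w : HeightOneSpectrum (NumberField.RingOfIntegers L)) [w.asIdeal.LiesOver v₂.asIdeal]
  (ψδ : PsiC w) (hK : ∀ a : v₂.adicCompletion ℚ, ψδ.1 (algebraMap (v₂.adicCompletion ℚ) (w.adicCompletion L) a) = 1)

/-- The local input at `ℚ₂ ⊆ ℚ₂(i)`: the ramified place data `gaussianPlace w`, the toy ε-factor parameter, the
given `ψ_δ` trivial on `ℚ₂`, the toy Weil representation (non-zero for both signs, `good_nonempty`). -/
def gaussianInput : LocalInput v₂ w where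
  place := Sum.inr (gaussianPlace w)
  P := (gaussianPlace w).toyP
  ψδ := ψδ
  hK := hK
  R := weilT (gaussianPlace w) ψδ
  nontriv := nontrivial_wsp v₂ w (Uπ w (gaussianPlace w).π) (sgnT (gaussianPlace w) ψδ)
    (good_nonempty (gaussianPlace w) ψδ hK)

/-- Every hypothesis of the ramified statement of record v2 holds on the Gaussian input. -/
theorem gaussianInput_hyps : (gaussianInput w ψδ hK).Hyps := by
  show (gaussianInput w ψδ hK).RamHyps (gaussianPlace w)
  exact ⟨(gaussianPlace w).hT6_toy ψδ, (gaussianPlace w).hG_toy ψδ, h35_toy (gaussianPlace w) ψδ,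
    fun s => isSmoothCompact v₂ w (Uπ w (gaussianPlace w).π) (sgnT (gaussianPlace w) ψδ)
      (finiteIndex_Fsub_sup_Uπ (gaussianPlace w)) s,
    fun s => isSmoothOpen v₂ w (Uπ w (gaussianPlace w).π) (sgnT (gaussianPlace w) ψδ)
      (Uπ_antitone w (gaussianPlace w).π) s,
    rfl, hχW_toy (gaussianPlace w) ψδ⟩

/-- The finite non-split place above `2` of `ℚ ⊆ ℚ(ζ₄)` with its input. -/
def gaussianNS : NSPlace ℚ L where
  v := v₂
  w := w
  X := gaussianInput w ψδ hK

/-- THE PLACE FAMILY on `ℚ ⊆ ℚ(ζ₄)` over `Bool`: `true` the finite non-split place above `2`, `false` a real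
place. -/
def gaussianFamily : PlaceFamily ℚ L Bool where
  kind := fun b => if b then PlaceKind.ns else PlaceKind.re
  ns := fun _ _ => gaussianNS w ψδ hK

/-- The per-place hypotheses hold on the Gaussian family. -/
theorem gaussianFamily_hyps : (gaussianFamily w ψδ hK).Hyps := fun _ _ => gaussianInput_hyps w ψδ hK

/-- `hsol ∧ hre` ON THE GAUSSIAN FAMILY'S SIGN MODEL with t6-p7's toy real data on both sides — every hypothesis of
`PlaceFamily.solves_and_realCondB` discharged. -/
theorem gaussianFamily_solves_realCondB :
    ((gaussianFamily w ψδ hK).signModel (gaussianFamily_hyps w ψδ hK) (fun _ => Toy.toy) (fun _ => Toy.toy)).Solves ∧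
    ((gaussianFamily w ψδ hK).signModel (gaussianFamily_hyps w ψδ hK) (fun _ => Toy.toy)
      (fun _ => Toy.toy)).RealCondB :=
  (gaussianFamily w ψδ hK).solves_and_realCondB (gaussianFamily_hyps w ψδ hK) _ _
    (fun _ _ => Toy.toy_thm3_5) (fun _ _ => Toy.toy_thm3_5) (fun _ _ => Toy.toy_fockDict)
    (fun _ _ => Toy.toy_fockDict) (fun _ _ => Toy.toy_halfLine) (fun _ _ => Toy.toy_halfLine)

/-- The real place of the family is genuinely there (`false` has kind `re`), and the finite one (`true` has kind
`ns`). -/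
theorem gaussianFamily_kinds : (gaussianFamily w ψδ hK).kind true = .ns ∧ (gaussianFamily w ψδ hK).kind false = .re :=
  ⟨rfl, rfl⟩

/-- A RICH N5 DATUM carrying the Gaussian family's sign model: t6-p7's toy carriers on both sides, trivial factor
and restrictions, central values `1`. -/
def witnessRich : RichData Bool (Multiplicative ℤ) where
  repA := N5RichToyData.toyRep
  repB := N5RichToyData.toyRep
  S := (gaussianFamily w ψδ hK).signModel (gaussianFamily_hyps w ψδ hK) (fun _ => Toy.toy) (fun _ => Toy.toy)
  f := 1
  rA := 1
  rB := 1
  LvalA := fun _ => 1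
  LvalB := fun _ => 1

/-- THE TWO RESIDUAL BINDERS `hsol` / `hre` OF `HCCMOfPublished₂` (ledger rows 183–184) ON A RICH DATUM, through
`PlaceFamily.solves_realCondB_of_eq`. -/
theorem witnessRich_solves_realCondB : (witnessRich w ψδ hK).S.Solves ∧ (witnessRich w ψδ hK).S.RealCondB :=
  (gaussianFamily w ψδ hK).solves_realCondB_of_eq (witnessRich w ψδ hK) (gaussianFamily_hyps w ψδ hK) _ _ rfl
    (fun _ _ => Toy.toy_thm3_5) (fun _ _ => Toy.toy_thm3_5) (fun _ _ => Toy.toy_fockDict)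
    (fun _ _ => Toy.toy_fockDict) (fun _ _ => Toy.toy_halfLine) (fun _ _ => Toy.toy_halfLine)

end Gaussian

/-- THE CLOSED WITNESS: on `ℚ ⊆ ℚ(ζ₄)` there is a place family (a finite non-split place and a real place) with
real data on both sides whose sign model satisfies `Solves ∧ RealCondB` — the two residual binders instantiated
with every hypothesis discharged, the place above `2` (`T5ConcretePlaces.wild`) and the datum's `ψ_δ`
(`exists_psi_trivial_on_base`) constructed. -/
theorem exists_signModel_solves_realCondB :
    ∃ (F : PlaceFamily ℚ T5GaussianField.L Bool) (hF : F.Hyps) (RA RB : Bool → RealData),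
      (F.signModel hF RA RB).Solves ∧ (F.signModel hF RA RB).RealCondB := by
  obtain ⟨w, hw⟩ := exists_place_above_two
  haveI := hw
  obtain ⟨ψδ, hK⟩ := N5LocalRamWitness.exists_psi_trivial_on_base (gaussianPlace w).h2 (gaussianPlace w).σ
    (gaussianPlace w).hσ
  exact ⟨gaussianFamily w ψδ hK, gaussianFamily_hyps w ψδ hK, fun _ => Toy.toy, fun _ => Toy.toy,
    gaussianFamily_solves_realCondB w ψδ hK⟩

/-! ### The inert place `ℚ₂ ⊆ ℚ₂(ω)` -/

section Eisenstein

open T5GaussianField T5EisensteinField T5EisensteinInertPlace N5LocalInertWitness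

variable (w : HeightOneSpectrum (NumberField.RingOfIntegers L₃)) [w.asIdeal.LiesOver v₂.asIdeal]

/-- The local input at the inert place `ℚ₂ ⊆ ℚ₂(ω)`: the inert place data `eisensteinPlace w`, the toy ε-factor
parameter, the normalised `ψ₁` as `ψ_δ`, the toy Weil representation. -/
def eisensteinInput : LocalInput v₂ w where
  place := Sum.inl (eisensteinPlace w)
  P := (eisensteinPlace w).toyP
  ψδ := (eisensteinPlace w).ψ₁
  hK := (eisensteinPlace w).ψ₁_algebraMap
  R := weilT (eisensteinPlace w)
  nontriv := nontrivial_wsp v₂ w (U v₂ w (eisensteinPlace w).ϖ) (sgnT (eisensteinPlace w))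
    (good_nonempty (eisensteinPlace w))

/-- Every hypothesis of the inert statement of record v2 holds on the Eisenstein input. -/
theorem eisensteinInput_hyps : (eisensteinInput w).Hyps := by
  show (eisensteinInput w).InertHyps (eisensteinPlace w)
  exact ⟨(eisensteinPlace w).hG_toy, (eisensteinPlace w).hT_toy, h35_toy (eisensteinPlace w),
    fun s => isSmoothCompact v₂ w (U v₂ w (eisensteinPlace w).ϖ) (sgnT (eisensteinPlace w))
      (finiteIndex_Fsub_sup_U (eisensteinPlace w)) s,
    fun s => isSmoothOpen v₂ w (U v₂ w (eisensteinPlace w).ϖ) (sgnT (eisensteinPlace w))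
      (U_antitone v₂ w (eisensteinPlace w).ϖ) s,
    rfl, hχW_toy (eisensteinPlace w)⟩

/-- The place family on `ℚ ⊆ ℚ(ζ₃)` over `Unit`: the single finite non-split place above `2`. -/
def eisensteinFamily : PlaceFamily ℚ L₃ Unit where
  kind := fun _ => PlaceKind.ns
  ns := fun _ _ => ⟨v₂, w, eisensteinInput w⟩

/-- `hsol` on the Eisenstein family's sign model (no real place: `hre` holds vacuously). -/
theorem eisensteinFamily_solves :
    ((eisensteinFamily w).signModel (fun _ _ => eisensteinInput_hyps w) (fun _ => Toy.toy)
      (fun _ => Toy.toy)).Solves ∧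
    ((eisensteinFamily w).signModel (fun _ _ => eisensteinInput_hyps w) (fun _ => Toy.toy)
      (fun _ => Toy.toy)).RealCondB :=
  ⟨(eisensteinFamily w).signModel_solves _ _ _, fun _ h => nomatch h⟩

end Eisenstein

end

end Summit.Ventures.HodgeRepro2.T6.N5LocalSignModelWitness
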